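import Summits.QuantumFields.YangMills.Theorems.LuscherReductionOneSiteLevelsValleyExpNear
import Summits.QuantumFields.YangMills.Theorems.LuscherReductionOneSiteLevelsValleyGauss
import Summits.QuantumFields.YangMills.Theorems.LuscherReductionOneSiteLevelsValleySchurKernel

/-!
# VALLEY, step 4e: the NEAR main term — from the chart exponent bound to a Gaussian integral over `ℝ⁹`
# (support module for `stub_absUpperValleyMag` of crux `OneSiteLevels`, route `LuscherReduction`, item stmt-QuantumFields-20007;
# fleet lead prover ym-luscher-20007-p1 g2)

For the VALLEY supersolution quantity `J_τ(U) = ∫ F_U(W) dW`, `F_U(W) = e^{(τ−½)BS(U)} E_B(U,U·W) e^{−(½+τ)BS(U·W)}`, this file bounds the MAIN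
part `∫_{D(W) ≤ δ'} F_U` (the kinetic ball) by a flat Gaussian integral: given Riesz data `g₀, r_m` of the gradient and the transverse
Hessian (`…ValleyRiesz.exists_riesz_near`) and `0 ≤ κ' ≤ (½+τ)B(1 − 36δ')`,

  `∫ 1[D(W) ≤ δ'] F_U(W) dW ≤ (2π²)⁻³ e^{6B − BS(U)(1 − 18δ'(½+τ))} ∫_{ℝ⁹} e^{−b‖y‖² − ⟨g,y⟩} (1 − (5/8) κ'Q(y) 1[κ'Q(y) ≤ ½]) dy`

with `b = B(1 − (9/4)δ' − (½+τ)(2√2√S(U) + 9δ'(2 + 36δ')))`, `g = (½+τ)B·g₀`, `Q(y) = Σ_m⟨r_m,y⟩²` (`near_main_le`): gnomonic chart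
(`integral_configMeasure_eq_sum_gnChart`; only the all-upper pattern meets the ball), density `≤ (2π²)⁻³`, the NEAR exponent bound
`near_exponent_le`, and `e^{−x} ≤ 1 − (5/8)x·1[x ≤ ½]`.

## WHAT THIS IS NOT
Not yet the NEAR bound (the Gaussian integral is evaluated in `…ValleyNear`); NOT the crux, NOT THE CLAY GAP.  Sorry-free; no new
definition, no named fact.
-/

set_option autoImplicit false

noncomputable section

open MeasureTheory Filter Topology Real
open scoped Matrix Quaternion RealInnerProductSpace BigOperators
open Literature.MathematicalPhysics.QuantumFieldTheory
open Literature.MathematicalPhysics.QuantumLattice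
open Literature.Analysis.OperatorTheory.YMMatrixModel

namespace Summit.QuantumFields.YangMills.Theorems.FemtoTransferGap

variable {B τ : ℝ}

/-- **Pointwise NEAR bound in the chart.**  On the kinetic ball `D(W(y)) ≤ δ' ≤ 1/36`:
`F_U(W(y)) ≤ e^{A₀} · e^{−b‖y‖² − ⟨g,y⟩} · (1 − (5/8)κ'Q(y)1[κ'Q(y) ≤ ½])`. [cite: SimonB1983DiscreteSpectrum, §2] -/
theorem near_integrand_le (hB : 0 < B) (hτ : 0 ≤ 1 / 2 + τ) (U : Cfg) {δ' : ℝ} (hδ'0 : 0 ≤ δ') (hδ' : δ' ≤ 1 / 36)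
    (g₀ : ZM) {M : Type*} [Fintype M] (r : M → ZM)
    (hg₀ : ∀ y : ZM, ⟪g₀, y⟫ = 4 * ∑ p : Fin 3 × Fin 3, (vecPart (U (edgeOf p.1)) ⨯₃ vecPart (U (edgeOf p.2))) ⬝ᵥ
          (vecPart (U (edgeOf p.1)) ⨯₃ (scalarPart (U (edgeOf p.2)) • colourVec y p.2 + vecPart (U (edgeOf p.2)) ⨯₃ colourVec y p.2)
            + (scalarPart (U (edgeOf p.1)) • colourVec y p.1 + vecPart (U (edgeOf p.1)) ⨯₃ colourVec y p.1) ⨯₃ vecPart (U (edgeOf p.2))))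
    (hr : ∀ y : ZM, ∑ m, ⟪r m, y⟫ ^ 2 = ∑ p : Fin 3 × Fin 3,
          (vecPart (U (edgeOf p.1)) ⨯₃ (scalarPart (U (edgeOf p.2)) • colourVec y p.2 + vecPart (U (edgeOf p.2)) ⨯₃ colourVec y p.2)
            + (scalarPart (U (edgeOf p.1)) • colourVec y p.1 + vecPart (U (edgeOf p.1)) ⨯₃ colourVec y p.1) ⨯₃ vecPart (U (edgeOf p.2)))
          ⬝ᵥ (vecPart (U (edgeOf p.1)) ⨯₃ (scalarPart (U (edgeOf p.2)) • colourVec y p.2 + vecPart (U (edgeOf p.2)) ⨯₃ colourVec y p.2)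
            + (scalarPart (U (edgeOf p.1)) • colourVec y p.1 + vecPart (U (edgeOf p.1)) ⨯₃ colourVec y p.1) ⨯₃ vecPart (U (edgeOf p.2))))
    {κ' : ℝ} (hκ'0 : 0 ≤ κ') (hκ' : κ' ≤ (1 / 2 + τ) * B * (1 - 36 * δ')) (y : ZM)
    (hy : ∑ e : Edge 3 1, (2 - 2 * scalarPart (gnChart 1 (fun _ => false) y e)) ≤ δ') :
    Real.exp ((τ - 1 / 2) * B * wilsonAction su2Rep U) *
        (linkE B U (U * gnChart 1 (fun _ => false) y) * Real.exp (-(1 / 2 + τ) * B * wilsonAction su2Rep (U * gnChart 1 (fun _ => false) y)))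
      ≤ Real.exp (6 * B - B * wilsonAction su2Rep U * (1 - 18 * δ' * (1 / 2 + τ))) *
        (Real.exp (-(B * (1 - 9 / 4 * δ' - (1 / 2 + τ) * (2 * Real.sqrt 2 * √(wilsonAction su2Rep U) + 9 * δ' * (2 + 36 * δ'))))
            * ‖y‖ ^ 2 - ⟪((1 / 2 + τ) * B) • g₀, y⟫)
          * (1 - 5 / 8 * (if κ' * ∑ m, ⟪r m, y⟫ ^ 2 ≤ 1 / 2 then κ' * ∑ m, ⟪r m, y⟫ ^ 2 else 0))) := by
  -- the blocks are small on the ball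
  have hη : ∀ i, vsq (colourVec y i) ≤ 3 * δ' := vsq_le_of_sumDefect_le y (by linarith) hy
  have hex := near_exponent_le τ hτ U y (η := 3 * δ') (by linarith) hη
  rw [← hg₀ y, ← hr y] at hex
  rw [linkE_eq_exp, ← Real.exp_add, ← Real.exp_add]
  -- exponent ≤ A₀ − b‖y‖² − ⟨g,y⟩ − κ Q
  have hQ0 : 0 ≤ ∑ m, ⟪r m, y⟫ ^ 2 := Finset.sum_nonneg fun _ _ => sq_nonneg _
  have hκQ : κ' * ∑ m, ⟪r m, y⟫ ^ 2 ≤ (1 / 2 + τ) * B * (1 - 12 * (3 * δ')) * ∑ m, ⟪r m, y⟫ ^ 2 := by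
    refine mul_le_mul_of_nonneg_right (hκ'.trans (le_of_eq (by ring))) hQ0
  have hB' := mul_le_mul_of_nonneg_left hex hB.le
  have key : (τ - 1 / 2) * B * wilsonAction su2Rep U + (B * timeCoupling su2Rep U (U * gnChart 1 (fun _ => false) y)
      + -(1 / 2 + τ) * B * wilsonAction su2Rep (U * gnChart 1 (fun _ => false) y))
      ≤ (6 * B - B * wilsonAction su2Rep U * (1 - 18 * δ' * (1 / 2 + τ)))
        + ((-(B * (1 - 9 / 4 * δ' - (1 / 2 + τ) * (2 * Real.sqrt 2 * √(wilsonAction su2Rep U) + 9 * δ' * (2 + 36 * δ'))))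
            * ‖y‖ ^ 2 - ⟪((1 / 2 + τ) * B) • g₀, y⟫) + -(κ' * ∑ m, ⟪r m, y⟫ ^ 2)) := by
    rw [real_inner_smul_left]
    nlinarith [hB', hκQ]
  refine (Real.exp_le_exp.2 key).trans ?_
  rw [Real.exp_add, Real.exp_add]
  refine mul_le_mul_of_nonneg_left (mul_le_mul_of_nonneg_left ?_ (Real.exp_pos _).le) (Real.exp_pos _).le
  exact GaussNear.exp_neg_le_one_sub_gain (mul_nonneg hκ'0 hQ0)

/-- `y ↦ e^{−b‖y‖² − ⟨g,y⟩}` is integrable (`b > 0`): a translated Gaussian. [folklore] -/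
theorem integrable_gauss_linear {b : ℝ} (hb : 0 < b) (g : ZM) :
    Integrable fun y : ZM => Real.exp (-b * ‖y‖ ^ 2 - ⟪g, y⟫) := by
  set s : ZM := (2 * b)⁻¹ • g with hs
  have h := (GaussForm.integrable_gauss (ι := Fin 3 × Fin 3) hb).comp_add_right s
  refine ((h.const_mul (Real.exp (b * ‖s‖ ^ 2))).congr (ae_of_all _ fun y => ?_))
  simp only
  rw [← Real.exp_add]
  congr 1
  have hn : ‖y + s‖ ^ 2 = ‖y‖ ^ 2 + 2 * ⟪y, s⟫ + ‖s‖ ^ 2 := norm_add_sq_real y s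
  have hys : ⟪y, s⟫ = (2 * b)⁻¹ * ⟪g, y⟫ := by rw [hs, real_inner_smul_right, real_inner_comm]
  rw [hn, hys]
  field_simp
  ring

/-- **The NEAR main term as a flat Gaussian integral.** [cite: SimonB1983DiscreteSpectrum, §2] -/
theorem near_main_le (hB : 0 < B) (hτ : 0 ≤ 1 / 2 + τ) (U : Cfg) {δ' : ℝ} (hδ'0 : 0 ≤ δ') (hδ' : δ' ≤ 1 / 36)
    (g₀ : ZM) {M : Type*} [Fintype M] (r : M → ZM)
    (hg₀ : ∀ y : ZM, ⟪g₀, y⟫ = 4 * ∑ p : Fin 3 × Fin 3, (vecPart (U (edgeOf p.1)) ⨯₃ vecPart (U (edgeOf p.2))) ⬝ᵥ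
          (vecPart (U (edgeOf p.1)) ⨯₃ (scalarPart (U (edgeOf p.2)) • colourVec y p.2 + vecPart (U (edgeOf p.2)) ⨯₃ colourVec y p.2)
            + (scalarPart (U (edgeOf p.1)) • colourVec y p.1 + vecPart (U (edgeOf p.1)) ⨯₃ colourVec y p.1) ⨯₃ vecPart (U (edgeOf p.2))))
    (hr : ∀ y : ZM, ∑ m, ⟪r m, y⟫ ^ 2 = ∑ p : Fin 3 × Fin 3,
          (vecPart (U (edgeOf p.1)) ⨯₃ (scalarPart (U (edgeOf p.2)) • colourVec y p.2 + vecPart (U (edgeOf p.2)) ⨯₃ colourVec y p.2)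
            + (scalarPart (U (edgeOf p.1)) • colourVec y p.1 + vecPart (U (edgeOf p.1)) ⨯₃ colourVec y p.1) ⨯₃ vecPart (U (edgeOf p.2)))
          ⬝ᵥ (vecPart (U (edgeOf p.1)) ⨯₃ (scalarPart (U (edgeOf p.2)) • colourVec y p.2 + vecPart (U (edgeOf p.2)) ⨯₃ colourVec y p.2)
            + (scalarPart (U (edgeOf p.1)) • colourVec y p.1 + vecPart (U (edgeOf p.1)) ⨯₃ colourVec y p.1) ⨯₃ vecPart (U (edgeOf p.2))))
    {κ' : ℝ} (hκ'0 : 0 ≤ κ') (hκ' : κ' ≤ (1 / 2 + τ) * B * (1 - 36 * δ'))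
    (hb : 0 < B * (1 - 9 / 4 * δ' - (1 / 2 + τ) * (2 * Real.sqrt 2 * √(wilsonAction su2Rep U) + 9 * δ' * (2 + 36 * δ')))) :
    ∫ W, {W : Cfg | ∑ e : Edge 3 1, (2 - 2 * scalarPart (W e)) ≤ δ'}.indicator
        (fun W => Real.exp ((τ - 1 / 2) * B * wilsonAction su2Rep U) *
          (linkE B U (U * W) * Real.exp (-(1 / 2 + τ) * B * wilsonAction su2Rep (U * W)))) W ∂(configMeasure SU2 1)
      ≤ ((2 * π ^ 2)⁻¹) ^ 3 * Real.exp (6 * B - B * wilsonAction su2Rep U * (1 - 18 * δ' * (1 / 2 + τ))) *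
        ∫ y : ZM, Real.exp (-(B * (1 - 9 / 4 * δ' - (1 / 2 + τ) * (2 * Real.sqrt 2 * √(wilsonAction su2Rep U) + 9 * δ' * (2 + 36 * δ'))))
            * ‖y‖ ^ 2 - ⟪((1 / 2 + τ) * B) • g₀, y⟫)
          * (1 - 5 / 8 * (if κ' * ∑ m, ⟪r m, y⟫ ^ 2 ≤ 1 / 2 then κ' * ∑ m, ⟪r m, y⟫ ^ 2 else 0)) := by
  set Ω : Set Cfg := {W : Cfg | ∑ e : Edge 3 1, (2 - 2 * scalarPart (W e)) ≤ δ'} with hΩ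
  set F : Cfg → ℝ := fun W => Real.exp ((τ - 1 / 2) * B * wilsonAction su2Rep U) *
      (linkE B U (U * W) * Real.exp (-(1 / 2 + τ) * B * wilsonAction su2Rep (U * W))) with hF
  set b : ℝ := B * (1 - 9 / 4 * δ' - (1 / 2 + τ) * (2 * Real.sqrt 2 * √(wilsonAction su2Rep U) + 9 * δ' * (2 + 36 * δ'))) with hbdef
  set g : ZM := ((1 / 2 + τ) * B) • g₀ with hgdef
  set A₀ : ℝ := 6 * B - B * wilsonAction su2Rep U * (1 - 18 * δ' * (1 / 2 + τ)) with hA₀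
  set Φ : ZM → ℝ := fun y => Real.exp (-b * ‖y‖ ^ 2 - ⟪g, y⟫) *
      (1 - 5 / 8 * (if κ' * ∑ m, ⟪r m, y⟫ ^ 2 ≤ 1 / 2 then κ' * ∑ m, ⟪r m, y⟫ ^ 2 else 0)) with hΦ
  -- measurability / boundedness of `1_Ω F`
  have hΩm : MeasurableSet Ω := measurableSet_le measurable_sumDefect measurable_const
  have hSm : Measurable fun W : Cfg => wilsonAction su2Rep (U * W) :=
    (continuous_wilsonAction su2Rep continuous_su2Rep).measurable.comp (measurable_const.mul measurable_id)
  have hFm : Measurable F :=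
    measurable_const.mul ((measurable_linkE_mul B U).mul (Real.measurable_exp.comp (measurable_const.mul hSm)))
  have hF0 : ∀ W, 0 ≤ F W := fun W => by rw [hF]; exact mul_nonneg (Real.exp_pos _).le (mul_nonneg (linkE_pos B _ _).le (Real.exp_pos _).le)
  have hFb : ∃ C : ℝ, ∀ W, |Ω.indicator F W| ≤ C := by
    refine ⟨Real.exp ((τ - 1 / 2) * B * wilsonAction su2Rep U) * (Real.exp (2 * B) ^ Fintype.card (Edge 3 1) * 1), fun W => ?_⟩
    refine (abs_indicator_le (fun W => ?_) W)
    rw [hF]; dsimp only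
    rw [abs_mul, abs_mul, abs_of_nonneg (Real.exp_pos _).le, abs_of_nonneg (linkE_pos B _ _).le, abs_of_nonneg (Real.exp_pos _).le]
    refine mul_le_mul_of_nonneg_left (mul_le_mul (linkE_le hB.le _ _) ?_ (Real.exp_pos _).le (by positivity)) (Real.exp_pos _).le
    rw [Real.exp_le_one_iff]
    have := wilsonAction_su2_nonneg (U * W)
    have : 0 ≤ (1 / 2 + τ) * B * wilsonAction su2Rep (U * W) := by positivity
    linarith
  rw [integral_configMeasure_eq_sum_gnChart one_pos (hFm.indicator hΩm) hFb]
  -- only the all-upper pattern meets the ball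
  have hzero : ∀ σ : Fin 3 → Bool, σ ≠ (fun _ => false) →
      ∫ y : ZM, gnDensityReal 1 y * Ω.indicator F (gnChart 1 σ y) = 0 := by
    intro σ hσ
    refine integral_eq_zero_of_ae (ae_of_all _ fun y => ?_)
    have hout : gnChart 1 σ y ∉ Ω := by
      simp only [hΩ, Set.mem_setOf_eq, not_le]
      have := two_lt_sumDefect_gnChart_of_ne y hσ
      linarith
    simp [Set.indicator_of_notMem hout]
  rw [Finset.sum_eq_single_of_mem (fun _ : Fin 3 => false) (Finset.mem_univ _) fun σ _ hσ => hzero σ hσ]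
  -- pointwise bound of the surviving integrand by `(2π²)⁻³ e^{A₀} Φ`
  have hΦ0 : ∀ y, 0 ≤ Φ y := fun y => by
    rw [hΦ]; dsimp only
    refine mul_nonneg (Real.exp_pos _).le ?_
    split_ifs with h
    · nlinarith [mul_nonneg hκ'0 (Finset.sum_nonneg fun m (_ : m ∈ Finset.univ) => sq_nonneg ⟪r m, y⟫)]
    · norm_num
  have hpt : ∀ y : ZM, gnDensityReal 1 y * Ω.indicator F (gnChart 1 (fun _ => false) y)
      ≤ ((2 * π ^ 2)⁻¹) ^ 3 * Real.exp A₀ * Φ y := by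
    intro y
    have hd := gnDensityReal_le one_pos y
    rw [one_pow, one_mul] at hd
    have hd0 := (gnDensityReal_pos one_pos y).le
    by_cases hin : gnChart 1 (fun _ => false) y ∈ Ω
    · rw [Set.indicator_of_mem hin]
      have hy : ∑ e : Edge 3 1, (2 - 2 * scalarPart (gnChart 1 (fun _ => false) y e)) ≤ δ' := hin
      have hFle : F (gnChart 1 (fun _ => false) y) ≤ Real.exp A₀ * Φ y := by
        rw [hF, hΦ, hA₀, hbdef, hgdef]
        exact near_integrand_le hB hτ U hδ'0 hδ' g₀ r hg₀ hr hκ'0 hκ' y hy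
      calc gnDensityReal 1 y * F (gnChart 1 (fun _ => false) y)
          ≤ ((2 * π ^ 2)⁻¹) ^ 3 * (Real.exp A₀ * Φ y) := mul_le_mul hd hFle (hF0 _) (by positivity)
        _ = ((2 * π ^ 2)⁻¹) ^ 3 * Real.exp A₀ * Φ y := by ring
    · rw [Set.indicator_of_notMem hin, mul_zero]
      exact mul_nonneg (by positivity) (hΦ0 y)
  -- integrability
  have hΦint : Integrable Φ := by
    have hbpos : 0 < b := hb
    have hG := integrable_gauss_linear hbpos g
    refine (hG.mono' ?_ (ae_of_all _ fun y => ?_))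
    · have hQm : Measurable fun y : ZM => κ' * ∑ m, ⟪r m, y⟫ ^ 2 :=
        measurable_const.mul (continuous_finsetSum _ fun m _ => ((continuous_const.inner continuous_id).pow 2)).measurable
      exact (((by fun_prop : Continuous fun y : ZM => Real.exp (-b * ‖y‖ ^ 2 - ⟪g, y⟫)).measurable).mul
        (measurable_const.sub (measurable_const.mul (Measurable.ite (measurableSet_le hQm measurable_const) hQm
          measurable_const)))).aestronglyMeasurable
    · rw [Real.norm_eq_abs, abs_of_nonneg (hΦ0 y), hΦ]; dsimp only
      have h1 : (1 - 5 / 8 * (if κ' * ∑ m, ⟪r m, y⟫ ^ 2 ≤ 1 / 2 then κ' * ∑ m, ⟪r m, y⟫ ^ 2 else 0)) ≤ 1 := by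
        split_ifs
        · nlinarith [mul_nonneg hκ'0 (Finset.sum_nonneg fun m (_ : m ∈ Finset.univ) => sq_nonneg ⟪r m, y⟫)]
        · norm_num
      have h0 := Real.exp_pos (-b * ‖y‖ ^ 2 - ⟪g, y⟫)
      nlinarith
  have hLint : Integrable (fun y : ZM => gnDensityReal 1 y * Ω.indicator F (gnChart 1 (fun _ => false) y)) := by
    obtain ⟨C, hC⟩ := hFb
    have hm : AEStronglyMeasurable (fun y : ZM => Ω.indicator F (gnChart 1 (fun _ => false) y)) volume :=
      ((hFm.indicator hΩm).comp (measurable_gnChart 1 _)).aestronglyMeasurable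
    have h := (integrable_gnDensityReal one_pos).bdd_mul hm (c := C) (ae_of_all _ fun y => by rw [Real.norm_eq_abs]; exact hC _)
    simpa only [mul_comm] using h
  calc ∫ y : ZM, gnDensityReal 1 y * Ω.indicator F (gnChart 1 (fun _ => false) y)
      ≤ ∫ y : ZM, ((2 * π ^ 2)⁻¹) ^ 3 * Real.exp A₀ * Φ y := integral_mono hLint ((hΦint.const_mul _)) hpt
    _ = ((2 * π ^ 2)⁻¹) ^ 3 * Real.exp A₀ * ∫ y : ZM, Φ y := integral_const_mul _ _

end Summit.QuantumFields.YangMills.Theorems.FemtoTransferGap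

end
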